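import Literature.NumberTheory.EllipticCurves.BSDSelmerPConverseRationalHeegnerDescentProofs
import Literature.NumberTheory.EllipticCurves.HeegnerModuleIndex
import HarnessLib

/-!
# Howard's bound `corank_{ℤ_p} Sel_{p^∞}(E/K) ≤ 1 + 2 · ord_J 𝐋` from his Theorem B (proofs)

Sibling proof file (theorems only; no named fact is introduced, D-0014/D-0026) of
`Literature.NumberTheory.EllipticCurves.HeegnerModuleIndex`, for the named fact
`Literature.NumberTheory.EllipticCurves.Howard2004_selmerCorank_le` — B. Howard, *The Heegner point
Kolyvagin system*, Compositio Math. 140 (2004), §1, eq. (2):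
`rank_{ℤ_p} S_p(E/K) ≤ 1 + 2 · ord_J(𝐋)`, `J ⊂ Λ` the augmentation ideal,
`𝐋 = ch(H¹_{F_Λ}(K, 𝐓)/𝐇)`.

## The printed proof and its transcription

Howard, §1 (p. 3 of the held TeX `paper:arxiv-1202.6340`, after Theorem B): "by Mazur's control
theorem one has `rank_{ℤ_p} X/(γ - 1)X = corank_{ℤ_p} Sel_{p^∞}(E/K)` […] Similarly, part (c) of
the theorem, together with the control theorem, gives the inequality (2)". That is the whole
printed argument. Spelled out: Theorem B (b) `X ∼ Λ ⊕ M ⊕ M` and (c) `ch(M) ∣ 𝐋` give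
`rank_{ℤ_p} X/JX = 1 + 2 rank_{ℤ_p} M/JM ≤ 1 + 2 ord_J ch(M) ≤ 1 + 2 ord_J 𝐋` (structure theory
of finitely generated `Λ`-modules at the height-one prime `J = (T)`), and the control theorem
turns the left side into `corank_{ℤ_p} Sel_{p^∞}(E/K) = rank_{ℤ_p} S_p(E/K)`.

In the tree, Theorem B is the named fact `Howard2004_thmB` (file `HeegnerModuleIndex`), which
records (b)(c) in the pseudo-isomorphism-invariant form "`X` is finitely generated of `Λ`-rank one
and `char(X_{Λ-tors}) ∣ I(ℋ_∞)²`" (`X_{Λ-tors} ∼ M ⊕ M`; `I(ℋ_∞) = heegnerCharIdeal D F` is `𝐋`),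
and `ord_J 𝐋` is `heegnerModuleIndex D F = ℓ_𝔭(S/ℋ_∞)`, the local length at the augmentation
prime `𝔭 = (T) = primeT p`. This file PROVES the implication

* `Howard2004_selmerCorank_le_of_thmB : Howard2004_thmB … → Howard2004_selmerCorank_le …`,

so that the discharge `Howard2004_selmerCorank_le_holds` is exactly `Howard2004_thmB_holds` away
(Theorem B itself — the `Λ`-adic Kolyvagin-system argument that is the content of the paper — is
not proved in the tree). The two inputs used "together with" Theorem B are supplied as follows.

1. **Control theorem.** Only the inequality `corank_{ℤ_p} Sel_{p^∞}(E/K) ≤ rank_{ℤ_p} X/TX` is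
   needed for (2), and this half (Greenberg's Lemma 3.1 and restriction of characters) holds for
   EVERY `ℤ_p`-extension, in particular for the anticyclotomic one: tree theorem
   `WeierstrassCurve.selmerCorank_le_coinvariantsRank` (`KatoRankBoundSelmerProofs`), applied to the
   Iwasawa-module datum of `WeierstrassCurve.nonempty_selmerDualData_holds`.
2. **Module theory at `𝔭 = (T)`** (generic, namespace `IwasawaAlgebra`, proved here; Washington
   §13.2, Bourbaki AC VII §4.4):
   * `lengthAt_coinvariants_eq_one_of_finrank_eq_one`: for `Q` finitely generated, torsion-free
     of `Λ`-rank one, `ℓ_𝔭(Q/TQ) = 1` — the snake lemma for multiplication by `T` on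
     `0 → Λq → Q → Q/Λq → 0` (tree `snakeDelta`; `Q/Λq` is torsion, so
     `ℓ_𝔭((Q/Λq)[T]) = ℓ_𝔭((Q/Λq)/T)`, tree `lengthAt_invariants_eq_lengthAt_coinvariants`, while
     `Q[T] = 0` and `ℓ_𝔭(Λ/TΛ) = 1`);
   * `coinvariantsRank_le_one_add_lengthAt_torsion`: for `X` finitely generated of `Λ`-rank one,
     `rank_{ℤ_p} X/TX ≤ 1 + ℓ_𝔭(X_{Λ-tors})` (right exactness of `Γ`-coinvariants on
     `0 → X_tors → X → Q → 0`) — in Howard's notation `rank X/JX = 1 + 2 rank M/JM ≤ 1 + ord_J ch(M)²`;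
   * `charIdeal_eq_primeT_pow_mul`, `le_of_primeT_pow_mul_le`,
     `lengthAt_primeT_le_two_mul_of_charIdeal_dvd_sq`: `char(X_tors) ∣ I² ⟹ ℓ_𝔭(X_tors) ≤ 2 ℓ_𝔭(S/ℋ_∞)`
     — `char(N) = 𝔭^e · A` with `A ⊄ 𝔭` and `e ≤ ℓ_𝔭(N)` (`e = ℓ_𝔭(N)` unless the characteristic
     ideal takes its documented junk value `1`), and `I² ⊆ char(X_tors) ⊆ 𝔭^{ℓ_𝔭(X_tors)}`;
   * assembled: `coinvariantsRank_le_one_add_two_mul_lengthAt` (`rank_{ℤ_p} X/TX ≤ 1 + 2 ℓ_𝔭(N)`)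
     and, with the control inequality, `selmerCorank_le_one_add_two_mul_heegnerModuleIndex` — the
     bound (2) from the SHAPE of Theorem B (rank one, `char(X_tors) ∣ I(ℋ_∞)²`) for any
     `ℤ_p`-extension and any elliptic `E/K`, i.e. off Howard's hypotheses.

Nothing is asserted: the file adds no `def … : Prop`.

## References

* [Howard2004HeegnerKolyvagin] B. Howard, *The Heegner point Kolyvagin system*, Compositio Math.
  140 (2004), 1439–1472 (held: `paper:arxiv-1202.6340`): §1, Thm. B and eq. (2), with the two
  sentences quoted above (held TeX p. 3, lines 128–143; p. 4, lines 1–2).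
* R. Greenberg, *Iwasawa theory for elliptic curves*, LNM 1716 (1999), §1 p. 65 and §3 Lemma 3.1
  (the control inequality). [GreenbergLNM1716]
* L. C. Washington, *Introduction to Cyclotomic Fields*, GTM 83, §13.2; N. Bourbaki, *Algèbre
  commutative* VII §4.4–4.5 (local lengths, characteristic ideals). [Washington1997]
-/

noncomputable section

universe u v w

namespace Literature.NumberTheory.EllipticCurves.IwasawaAlgebra

variable (p : ℕ) [Fact p.Prime]

/-! ### `ℓ_𝔭(Q_Γ) = 1` for a finitely generated torsion-free `Λ`-module of rank one -/

/-- **`ℓ_𝔭(Q/TQ) = 1` for `Q` finitely generated, torsion-free, of `Λ`-rank one** (`𝔭 = (T)`; in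
structure-theorem terms `Q ↪ Λ` with finite cokernel and `rank_{ℤ_p} Q/TQ = rank_{ℤ_p} Λ/TΛ = 1`).
Proof: for `q ∈ Q ∖ 0` the sequence `0 → Λ → Q → M → 0`, `a ↦ a q`, is exact with `M = Q/Λq`
finitely generated torsion (rank–nullity, `isTorsion_quotient_span_singleton_of_finrank_eq_one`);
the snake lemma for multiplication by `T` gives `Q[T] → M[T] →δ Λ/TΛ → Q/TQ → M/TM → 0` with
`Q[T] = 0`, so `ℓ_𝔭(Λ/TΛ) = ℓ_𝔭(M[T]) + ℓ_𝔭(im)` and `ℓ_𝔭(Q/TQ) = ℓ_𝔭(im) + ℓ_𝔭(M/TM)`, while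
`ℓ_𝔭(M[T]) = ℓ_𝔭(M/TM)` for the torsion module `M`
(`lengthAt_invariants_eq_lengthAt_coinvariants`) and `ℓ_𝔭(Λ/TΛ) = 1`. Washington §13.2;
Bourbaki AC VII §4.4. [folklore] -/
theorem lengthAt_coinvariants_eq_one_of_finrank_eq_one {Q : Type u} [AddCommGroup Q]
    [Module (IwasawaAlgebra p) Q] [Module.Finite (IwasawaAlgebra p) Q]
    [Module.IsTorsionFree (IwasawaAlgebra p) Q]
    (hQ1 : Module.finrank (IwasawaAlgebra p) Q = 1) :
    Module.lengthAt (IwasawaAlgebra p) (coinvariants p Q) (primeT p) = 1 := by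
  haveI : NoZeroSMulDivisors (IwasawaAlgebra p) Q := ⟨fun h ↦ smul_eq_zero.mp h⟩
  haveI : Nontrivial Q := Module.nontrivial_of_finrank_pos (R := IwasawaAlgebra p) (by omega)
  obtain ⟨q, hq⟩ := exists_ne (0 : Q)
  -- `0 → Λ → Q → M → 0` with `f a = a • q` and `M = Q/Λq` finitely generated torsion
  let f : IwasawaAlgebra p →ₗ[IwasawaAlgebra p] Q :=
    LinearMap.toSpanSingleton (IwasawaAlgebra p) Q q
  let g : Q →ₗ[IwasawaAlgebra p] Q ⧸ Submodule.span (IwasawaAlgebra p) {q} :=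
    (Submodule.span (IwasawaAlgebra p) {q}).mkQ
  have hf : Function.Injective f := by
    rw [injective_iff_map_eq_zero]
    intro a ha
    change a • q = 0 at ha
    exact (smul_eq_zero.mp ha).resolve_right hq
  have hg : Function.Surjective g := Submodule.mkQ_surjective _
  have hfg : Function.Exact f g := by
    rw [LinearMap.exact_iff, Submodule.ker_mkQ, LinearMap.span_singleton_eq_range]
  have hM : Module.IsTorsion (IwasawaAlgebra p) (Q ⧸ Submodule.span (IwasawaAlgebra p) {q}) :=
    isTorsion_quotient_span_singleton_of_finrank_eq_one p hQ1 hq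
  -- the connecting map `δ : M[T] → Λ/TΛ` is injective because `Q[T] = 0`
  have hQT : ∀ x : invariants p Q, x = 0 := fun x ↦
    Subtype.ext ((smul_eq_zero.mp ((mem_invariants_iff p Q (x : Q)).mp x.2)).resolve_left
      PowerSeries.X_ne_zero)
  have hδ : Function.Injective (snakeDelta f g hf hg hfg) := by
    rw [injective_iff_map_eq_zero]
    intro y hy
    obtain ⟨x, rfl⟩ := (exact_invariantsMap_snakeDelta f g hf hg hfg y).mp hy
    rw [hQT x, map_zero]
  -- `ℓ(Λ_Γ) = ℓ(ker f_Γ) + ℓ(im f_Γ) = ℓ(M[T]) + ℓ(im f_Γ)`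
  have h1 : Module.lengthAt (IwasawaAlgebra p) (coinvariants p (IwasawaAlgebra p)) (primeT p) =
      Module.lengthAt (IwasawaAlgebra p)
          (invariants p (Q ⧸ Submodule.span (IwasawaAlgebra p) {q})) (primeT p) +
        Module.lengthAt (IwasawaAlgebra p) (LinearMap.range (coinvariantsMap f)) (primeT p) := by
    rw [Module.lengthAt_eq_add_of_exact (LinearMap.ker (coinvariantsMap f)).subtype
        (coinvariantsMap f).rangeRestrict (Submodule.subtype_injective _)
        (LinearMap.surjective_rangeRestrict _)
        (LinearMap.exact_iff.mpr (by rw [LinearMap.ker_rangeRestrict, Submodule.range_subtype]))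
        (primeT p),
      LinearMap.exact_iff.mp (exact_snakeDelta_coinvariantsMap f g hf hg hfg),
      ← Module.lengthAt_eq_of_linearEquiv (LinearEquiv.ofInjective _ hδ) (primeT p)]
  -- `ℓ(Q_Γ) = ℓ(im f_Γ) + ℓ(M_Γ)`
  have h2 : Module.lengthAt (IwasawaAlgebra p) (coinvariants p Q) (primeT p) =
      Module.lengthAt (IwasawaAlgebra p) (LinearMap.range (coinvariantsMap f)) (primeT p) +
        Module.lengthAt (IwasawaAlgebra p)
          (coinvariants p (Q ⧸ Submodule.span (IwasawaAlgebra p) {q})) (primeT p) := by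
    refine Module.lengthAt_eq_add_of_exact (LinearMap.range (coinvariantsMap f)).subtype
      (coinvariantsMap g) (Submodule.subtype_injective _) (coinvariantsMap_surjective g hg)
      (LinearMap.exact_iff.mpr ?_) (primeT p)
    rw [Submodule.range_subtype]
    exact LinearMap.exact_iff.mp (exact_coinvariantsMap f g hg hfg)
  rw [lengthAt_coinvariants_self p, lengthAt_invariants_eq_lengthAt_coinvariants p _ hM] at h1
  rw [h2, add_comm]
  exact h1.symm

/-- **`rank_{ℤ_p} X/TX ≤ 1 + ℓ_𝔭(X_{Λ-tors})` for a finitely generated `Λ`-module `X` of rank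
one** (`𝔭 = (T)`). With `Q = X/X_tors` (torsion-free of rank one, rank–nullity over the domain `Λ`)
the sequence `(X_tors)_Γ → X_Γ → Q_Γ → 0` is exact (`exact_coinvariantsMap`), whence
`ℓ_𝔭(X_Γ) ≤ ℓ_𝔭((X_tors)_Γ) + ℓ_𝔭(Q_Γ) ≤ ℓ_𝔭(X_tors) + 1`
(`lengthAt_coinvariants_eq_one_of_finrank_eq_one`), and `ℓ_𝔭(X_Γ) = rank_{ℤ_p} X/TX`
(`lengthAt_coinvariants_eq_coinvariantsRank`). In the notation of Howard 2004, Thm. B (b):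
`X ∼ Λ ⊕ M ⊕ M`, `rank_{ℤ_p} X/JX = 1 + 2 rank_{ℤ_p} M/JM ≤ 1 + ord_J ch(M ⊕ M)`.
Washington §13.2. [folklore] -/
theorem coinvariantsRank_le_one_add_lengthAt_torsion {X : Type u} [AddCommGroup X]
    [Module (IwasawaAlgebra p) X] [Module.Finite (IwasawaAlgebra p) X]
    (hX1 : Module.finrank (IwasawaAlgebra p) X = 1) :
    (coinvariantsRank p X : ℕ∞) ≤
      1 + Module.lengthAt (IwasawaAlgebra p) (Submodule.torsion (IwasawaAlgebra p) X) (primeT p) := by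
  set Xt := Submodule.torsion (IwasawaAlgebra p) X with hXt
  -- `Q = X/X_tors` is torsion-free of rank one
  have htors : Module.IsTorsion (IwasawaAlgebra p) Xt := Submodule.torsion_isTorsion
  have hQ1 : Module.finrank (IwasawaAlgebra p) (X ⧸ Xt) = 1 := by
    have hsum := rank_quotient_add_rank_of_isDomain Xt
    rw [rank_eq_zero_iff_isTorsion.mpr htors, add_zero] at hsum
    rw [Module.finrank, hsum]
    exact hX1
  have hQ := lengthAt_coinvariants_eq_one_of_finrank_eq_one p hQ1
  -- right exactness `(X_tors)_Γ → X_Γ → Q_Γ → 0`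
  have hex := exact_coinvariantsMap Xt.subtype Xt.mkQ (Submodule.mkQ_surjective _)
    (LinearMap.exact_subtype_mkQ Xt)
  have h := Module.lengthAt_le_add_of_exact _ _ hex (primeT p)
  rw [lengthAt_coinvariants_eq_coinvariantsRank p X, hQ] at h
  have ht : Module.lengthAt (IwasawaAlgebra p) (coinvariants p Xt) (primeT p) ≤
      Module.lengthAt (IwasawaAlgebra p) Xt (primeT p) :=
    Module.lengthAt_quotient_le _ (primeT p)
  calc (coinvariantsRank p X : ℕ∞)
      ≤ Module.lengthAt (IwasawaAlgebra p) (coinvariants p Xt) (primeT p) + 1 := h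
    _ = 1 + Module.lengthAt (IwasawaAlgebra p) (coinvariants p Xt) (primeT p) := add_comm _ _
    _ ≤ 1 + Module.lengthAt (IwasawaAlgebra p) Xt (primeT p) := add_le_add_right ht 1

/-! ### The exponent of `𝔭 = (T)` in a characteristic ideal -/

/-- **`char(N) = 𝔭^e · A` with `A ⊄ 𝔭` and `e ≤ ℓ_𝔭(N)`** (`𝔭 = (T)`), for ANY `Λ`-module `N`:
the characteristic ideal `∏_{ht 𝔮 = 1} 𝔮^{ℓ_𝔮(N)}` (`Module.charIdeal`, a `finprod`) is either an
honest finite product — then `e = ℓ_𝔮(N)` (as `toNat`) and `A` is the product over the height-one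
primes `𝔮 ≠ 𝔭`, none of which is contained in `𝔭` (`eq_of_height_eq_one_of_le`), so that the prime
`𝔭` does not contain `A` — or takes its documented junk value `1`, when `e = 0`, `A = Λ`.
Bourbaki AC VII §4.5; Washington §13.2. [folklore] -/
theorem charIdeal_eq_primeT_pow_mul (N : Type v) [AddCommGroup N] [Module (IwasawaAlgebra p) N] :
    ∃ (e : ℕ) (A : Ideal (IwasawaAlgebra p)),
      (e : ℕ∞) ≤ Module.lengthAt (IwasawaAlgebra p) N (primeT p) ∧
      ¬ A ≤ (primeT p).asIdeal ∧
      Module.charIdeal (IwasawaAlgebra p) N = (primeT p).asIdeal ^ e * A := by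
  classical
  set g : PrimeSpectrum (IwasawaAlgebra p) → Ideal (IwasawaAlgebra p) := fun 𝔮 ↦
    𝔮.asIdeal ^ (Module.lengthAt (IwasawaAlgebra p) N 𝔮).toNat with hg
  have hchar : Module.charIdeal (IwasawaAlgebra p) N =
      ∏ᶠ 𝔮 ∈ {𝔮 : PrimeSpectrum (IwasawaAlgebra p) | 𝔮.asIdeal.height = 1}, g 𝔮 := rfl
  have hT : ¬ (⊤ : Ideal (IwasawaAlgebra p)) ≤ (primeT p).asIdeal := fun h ↦
    (primeT p).isPrime.ne_top (top_le_iff.mp h)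
  -- a finite product of `g 𝔮` over height-one primes `𝔮 ≠ 𝔭` is not contained in `𝔭`
  have key : ∀ S : Finset (PrimeSpectrum (IwasawaAlgebra p)),
      (∀ 𝔮 ∈ S, 𝔮.asIdeal.height = 1 ∧ 𝔮 ≠ primeT p) →
        ¬ ∏ 𝔮 ∈ S, g 𝔮 ≤ (primeT p).asIdeal := by
    intro S hS hle
    obtain ⟨𝔮, h𝔮S, h𝔮le⟩ := (primeT p).isPrime.prod_le.mp hle
    obtain ⟨h1, hneT⟩ := hS 𝔮 h𝔮S
    exact hneT (eq_of_height_eq_one_of_le h1 (height_primeT p) (Ideal.IsPrime.le_of_pow_le h𝔮le))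
  by_cases hfin : ({𝔮 : PrimeSpectrum (IwasawaAlgebra p) | 𝔮.asIdeal.height = 1} ∩
      Function.mulSupport g).Finite
  · rw [finprod_mem_eq_prod g hfin] at hchar
    set S := hfin.toFinset with hS
    have hmem : ∀ 𝔮 ∈ S, 𝔮.asIdeal.height = 1 := fun 𝔮 h𝔮 ↦ by
      rw [hS, Set.Finite.mem_toFinset, Set.mem_inter_iff, Set.mem_setOf_eq] at h𝔮
      exact h𝔮.1
    by_cases hT𝔭 : primeT p ∈ S
    · refine ⟨(Module.lengthAt (IwasawaAlgebra p) N (primeT p)).toNat,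
        ∏ 𝔮 ∈ S.erase (primeT p), g 𝔮, ENat.coe_toNat_le_self _, key _ (fun 𝔮 h𝔮 ↦ ?_), ?_⟩
      · rw [Finset.mem_erase] at h𝔮
        exact ⟨hmem 𝔮 h𝔮.2, h𝔮.1⟩
      · rw [hchar, ← Finset.mul_prod_erase S g hT𝔭]
    · refine ⟨0, ∏ 𝔮 ∈ S, g 𝔮, by simp, key _ (fun 𝔮 h𝔮 ↦ ?_), ?_⟩
      · exact ⟨hmem 𝔮 h𝔮, fun h ↦ hT𝔭 (h ▸ h𝔮)⟩
      · rw [hchar, pow_zero, one_mul]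
  · refine ⟨0, ⊤, by simp, hT, ?_⟩
    rw [hchar, finprod_mem_eq_one_of_infinite hfin, pow_zero, one_mul, Ideal.one_eq_top]

/-- **`𝔭^e · A ⊆ (T^l)` with `A ⊄ 𝔭` forces `l ≤ e`** (`𝔭 = (T)`): for `a ∈ A ∖ 𝔭`, i.e.
`a(0) ≠ 0`, `T^l ∣ T^e a` gives `l ≤ e` by comparing the coefficients of `T^e`. (The `𝔭`-adic
valuation of `Λ_𝔭`, a discrete valuation ring.) [folklore] -/
theorem le_of_primeT_pow_mul_le {e l : ℕ} {A : Ideal (IwasawaAlgebra p)}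
    (hA : ¬ A ≤ (primeT p).asIdeal)
    (h : (primeT p).asIdeal ^ e * A ≤ Ideal.span {(PowerSeries.X : IwasawaAlgebra p) ^ l}) :
    l ≤ e := by
  obtain ⟨a, haA, ha𝔭⟩ := SetLike.not_le_iff_exists.mp hA
  have hmem : (PowerSeries.X : IwasawaAlgebra p) ^ e * a ∈
      Ideal.span {(PowerSeries.X : IwasawaAlgebra p) ^ l} := by
    refine h (Ideal.mul_mem_mul ?_ haA)
    rw [primeT_asIdeal, Ideal.span_singleton_pow]
    exact Ideal.mem_span_singleton_self _
  refine le_of_not_gt fun hlt ↦ ?_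
  have hcoeff := PowerSeries.X_pow_dvd_iff.mp (Ideal.mem_span_singleton.mp hmem) e hlt
  rw [PowerSeries.coeff_X_pow_mul', if_pos le_rfl, Nat.sub_self,
    PowerSeries.coeff_zero_eq_constantCoeff_apply] at hcoeff
  exact ha𝔭 ((mem_span_X_iff p a).mpr hcoeff)

/-- **`char(X_t) ∣ char(N)² ⟹ ℓ_𝔭(X_t) ≤ 2 ℓ_𝔭(N)`** at `𝔭 = (T)`, for `X_t` finitely generated
torsion and any `Λ`-module `N` (`ord_J` is additive and monotone under divisibility; Howard's step
"`ch(M) ∣ 𝐋 ⟹ ord_J ch(M) ≤ ord_J 𝐋`"): `char(N)² = 𝔭^{2e} A²` with `A² ⊄ 𝔭`, `e ≤ ℓ_𝔭(N)`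
(`charIdeal_eq_primeT_pow_mul`), and `char(N)² ⊆ char(X_t) ⊆ 𝔭^{ℓ_𝔭(X_t)}` (`char(X_t)` is an
honest finite product containing the factor `𝔭^{ℓ_𝔭(X_t)}`, `finite_mulSupport_charFactor`,
`lengthAt_primeT_ne_top`), so `ℓ_𝔭(X_t) ≤ 2e` (`le_of_primeT_pow_mul_le`).
[cite: Howard2004HeegnerKolyvagin, §1 eq. (2)] -/
theorem lengthAt_primeT_le_two_mul_of_charIdeal_dvd_sq {Xt : Type v} {N : Type w}
    [AddCommGroup Xt] [Module (IwasawaAlgebra p) Xt] [Module.Finite (IwasawaAlgebra p) Xt]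
    [AddCommGroup N] [Module (IwasawaAlgebra p) N]
    (hXt : Module.IsTorsion (IwasawaAlgebra p) Xt)
    (hc : Module.charIdeal (IwasawaAlgebra p) Xt ∣ Module.charIdeal (IwasawaAlgebra p) N ^ 2) :
    Module.lengthAt (IwasawaAlgebra p) Xt (primeT p) ≤
      2 * Module.lengthAt (IwasawaAlgebra p) N (primeT p) := by
  have hne := lengthAt_primeT_ne_top Xt hXt
  set l := (Module.lengthAt (IwasawaAlgebra p) Xt (primeT p)).toNat with hl
  -- `char(X_t) ⊆ 𝔭^l = (T^l)`
  have hXle : Module.charIdeal (IwasawaAlgebra p) Xt ≤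
      Ideal.span {(PowerSeries.X : IwasawaAlgebra p) ^ l} := by
    rw [← Ideal.span_singleton_pow, ← primeT_asIdeal p]
    apply Ideal.le_of_dvd
    unfold Module.charIdeal
    rw [finprod_mem_def]
    have h := finprod_mem_dvd (primeT p) (finite_mulSupport_charFactor Xt hXt)
    rwa [Set.mulIndicator_of_mem (show primeT p ∈
      ({𝔮 | 𝔮.asIdeal.height = 1} : Set (PrimeSpectrum (IwasawaAlgebra p))) from
        height_primeT p)] at h
  -- `char(N) = 𝔭^e A`, `A ⊄ 𝔭`, `e ≤ ℓ_𝔭(N)`; `𝔭^{2e} A² = char(N)² ⊆ char(X_t) ⊆ (T^l)`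
  obtain ⟨e, A, he, hA, hN⟩ := charIdeal_eq_primeT_pow_mul p N
  have hA2 : ¬ A ^ 2 ≤ (primeT p).asIdeal := fun h ↦ hA (Ideal.IsPrime.le_of_pow_le h)
  have hle : (primeT p).asIdeal ^ (2 * e) * A ^ 2 ≤
      Ideal.span {(PowerSeries.X : IwasawaAlgebra p) ^ l} := by
    rw [mul_comm 2 e, pow_mul, ← mul_pow, ← hN]
    exact (Ideal.le_of_dvd hc).trans hXle
  have h2 := le_of_primeT_pow_mul_le p hA2 hle
  calc Module.lengthAt (IwasawaAlgebra p) Xt (primeT p) = (l : ℕ∞) := (ENat.coe_toNat hne).symm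
    _ ≤ ((2 * e : ℕ) : ℕ∞) := by exact_mod_cast h2
    _ = 2 * (e : ℕ∞) := by rw [Nat.cast_mul, Nat.cast_ofNat]
    _ ≤ 2 * Module.lengthAt (IwasawaAlgebra p) N (primeT p) := by gcongr

/-- **Howard's count: `rank_{ℤ_p} X/TX ≤ 1 + 2 ℓ_𝔭(N)`** for a finitely generated `Λ`-module `X`
of rank one whose torsion submodule satisfies `char(X_tors) ∣ char(N)²` (`𝔭 = (T)`; Howard 2004,
§1: `X ∼ Λ ⊕ M ⊕ M`, `ch(M) ∣ 𝐋 = char(N)` ⟹ `rank_{ℤ_p} X/JX ≤ 1 + 2 ord_J 𝐋`), from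
`coinvariantsRank_le_one_add_lengthAt_torsion` and
`lengthAt_primeT_le_two_mul_of_charIdeal_dvd_sq`. [cite: Howard2004HeegnerKolyvagin, §1 eq. (2)] -/
theorem coinvariantsRank_le_one_add_two_mul_lengthAt {X : Type u} {N : Type v}
    [AddCommGroup X] [Module (IwasawaAlgebra p) X] [Module.Finite (IwasawaAlgebra p) X]
    [AddCommGroup N] [Module (IwasawaAlgebra p) N]
    (hX1 : Module.finrank (IwasawaAlgebra p) X = 1)
    (hc : Module.charIdeal (IwasawaAlgebra p) (Submodule.torsion (IwasawaAlgebra p) X) ∣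
      Module.charIdeal (IwasawaAlgebra p) N ^ 2) :
    (coinvariantsRank p X : ℕ∞) ≤ 1 + 2 * Module.lengthAt (IwasawaAlgebra p) N (primeT p) := by
  have h1 := coinvariantsRank_le_one_add_lengthAt_torsion p hX1
  have h2 := lengthAt_primeT_le_two_mul_of_charIdeal_dvd_sq p
    (Submodule.torsion_isTorsion (R := IwasawaAlgebra p) (M := X)) hc
  exact h1.trans (add_le_add_right h2 1)

end Literature.NumberTheory.EllipticCurves.IwasawaAlgebra

/-! ### Howard 2004, §1 eq. (2) from Theorem B -/

namespace Literature.NumberTheory.EllipticCurves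

open IwasawaAlgebra

variable {N : ℕ} [NeZero N] {W : WeierstrassCurve ℚ} {K : Type u} [Field K] [NumberField K]
  {p : ℕ} [Fact p.Prime] {κ : ZpExtension K p} {γ : Field.absoluteGaloisGroup K}
  {jbar : AlgebraicClosure K →+* ℂ}

/-- **`corank_{ℤ_p} Sel_{p^∞}(E/K) ≤ 1 + 2 · ord_J I(ℋ_∞)` from the SHAPE of Howard's Theorem B**,
for an elliptic curve `E/K` over a number field, any `ℤ_p`-extension `κ` with topological generator
`γ`, an Iwasawa-module datum `X` for `Sel_{p^∞}(E/K_∞)` with `X` finitely generated of `Λ`-rank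
one, and a `Λ`-adic Selmer datum `D` with Heegner family `F` such that
`char(X_{Λ-tors}) ∣ I(ℋ_∞)²` (Thm. B (b), (c)): the control inequality
`corank Sel_{p^∞}(E/K) ≤ rank_{ℤ_p} X/TX` (`WeierstrassCurve.selmerCorank_le_coinvariantsRank`,
valid for every `ℤ_p`-extension) followed by `coinvariantsRank_le_one_add_two_mul_lengthAt`
(`ord_J I(ℋ_∞) = heegnerModuleIndex D F = ℓ_𝔭(S/ℋ_∞)`). Howard 2004, §1: "part (c) of the
theorem, together with the control theorem, gives the inequality (2)".
[cite: Howard2004HeegnerKolyvagin, §1 eq. (2)] -/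
theorem selmerCorank_le_one_add_two_mul_heegnerModuleIndex [W.IsElliptic]
    (hγ : κ.IsTopGenerator γ) (X : (W.baseChange K).SelmerDualData κ γ)
    [Module.Finite (IwasawaAlgebra p) X.X] (hX1 : Module.finrank (IwasawaAlgebra p) X.X = 1)
    (D : (W.baseChange K).LambdaAdicSelmerData κ γ) (F : HeegnerFamily N W K κ jbar)
    (hc : Module.charIdeal (IwasawaAlgebra p) (Submodule.torsion (IwasawaAlgebra p) X.X) ∣
      heegnerCharIdeal D F ^ 2) :
    (((W.baseChange K).selmerCorank p : ℕ) : ℕ∞) ≤ 1 + 2 * heegnerModuleIndex D F := by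
  have h1 : (((W.baseChange K).selmerCorank p : ℕ) : ℕ∞) ≤ (coinvariantsRank p X.X : ℕ∞) := by
    exact_mod_cast (W.baseChange K).selmerCorank_le_coinvariantsRank hγ X
  exact h1.trans (coinvariantsRank_le_one_add_two_mul_lengthAt p
    (N := D.S ⧸ heegnerModule D F) hX1 hc)

variable [W.IsGloballyMinimal]

/-- **Howard 2004, §1 eq. (2) from Theorem B: `Howard2004_thmB ⟹ Howard2004_selmerCorank_le`.**
Under `HowardHypotheses`, for every `Λ`-adic Selmer datum `D` and Heegner family `F`: take the
Iwasawa-module datum `X` of `WeierstrassCurve.nonempty_selmerDualData_holds` (`γ` is a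
topological generator), read off from Theorem B (as vendored, `Howard2004_thmB`) that `X` is
finitely generated of `Λ`-rank one with `char(X_{Λ-tors}) ∣ I(ℋ_∞)²`, and apply
`selmerCorank_le_one_add_two_mul_heegnerModuleIndex` (`E` is elliptic by `HowardHypotheses`).
This is the printed deduction "part (c) of the theorem, together with the control theorem, gives
the inequality (2)"; the discharge `Howard2004_selmerCorank_le_holds` is this theorem applied to a
proof of `Howard2004_thmB`. [cite: Howard2004HeegnerKolyvagin, §1 Thm. B and eq. (2)] -/
theorem Howard2004_selmerCorank_le_of_thmB (hB : Howard2004_thmB N W K p κ γ jbar) :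
    Howard2004_selmerCorank_le N W K p κ γ jbar := by
  intro hyp D F
  haveI := hyp.isElliptic
  obtain ⟨X⟩ := (W.baseChange K).nonempty_selmerDualData_holds κ γ hyp.topGenerator
  obtain ⟨-, hXfin, hX1, hc⟩ := hB hyp D F X
  exact selmerCorank_le_one_add_two_mul_heegnerModuleIndex hyp.topGenerator X hX1 D F hc

end Literature.NumberTheory.EllipticCurves
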